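import Summits.BirchSwinnertonDyer.Rank1Residual.X11b.BDPRouteSelmerCardBound
import Summits.BirchSwinnertonDyer.Rank1Residual.X11b.BDPRouteSelmerLevelBoundTorsion
import Summits.BirchSwinnertonDyer.Rank1Residual.X11b.BDPRouteLocalIndexTorsion
import Summits.BirchSwinnertonDyer.Rank1Residual.X11b.ZpLineIndexTorsion
import Summits.BirchSwinnertonDyer.Rank1Residual.X11b.QuadraticTorsionOfIrr
import Summits.BirchSwinnertonDyer.Rank1Residual.X11b.BDPRouteControlTorsion
import HarnessLib

/-!
# Class X11b, route "BDP + converse-theorem engine + Kolyvagin" (p2): the Selmer count WITHOUT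
# the erratum's (iv) — `#Sel_𝔭(K, E[p^∞]) · #E(ℚ_p)[p^∞] ≤ p^a`, Cas18 (3.2.1)+(calcul) `≤` with its
# `#H⁰(K_𝔭, E[p^∞])`-factor — and the control input (T1ᵗ-CTL≤) DISCHARGED ON ALL OF X11b, `p ≥ 5`
# (cell `b2b-bsdres`, `multr1-p2`, gen 17)

HONEST FRAMING (verbatim, cell `b2b-bsdres`): the goal of the cell is to DELETE the
COMBINATION-SHAPED residual classes for ALL analytic-rank `≤ 1` curves over `ℚ` — "full BSD
formula for every rank `≤ 1` curve in class `C`" assembled STRICTLY from published theorems — so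
that the rank-`≤ 1` remainder becomes exactly the CONSTRUCTION-SHAPED classes, which are TYPED
(missing-input Props), NOT attempted; this is not "finishing BSD". Research route `p2` for class
X11b; no claim beyond the stated class; nothing booked; X11b stays CONSTRUCTION-SHAPED. Theorems
only; no `sorry`; no new named fact (the textbook facts Poitou–Tate, local Euler characteristic and
Kolyvagin's theorem enter as hypotheses, as in gen 16).

## What this file proves

* `index_torsion_sup_range_zsmul_eq_padic`, `index_range_baseChange_sup_torsion_sup_eq_padic` —
  transport of the torsion subgroup of `E(K_𝔭)` along `E(K_𝔭) ≃ E(ℚ_p)` (gen 16's `pointTransportPadic`).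
* **`p2SelmerCardBoundTorsion_of_facts`** — at EVERY datum of route p2 (X11b pair, `p ≥ 5`, Heegner
  field `K`, Manin-good parametrisation, non-torsion Heegner point `P`, degree-one `𝔭 ∋ p`), with NO
  hypothesis on `E(ℚ_p)[p]`: `Sel_𝔭(K, E[p^∞])` is finite and
  `#Sel_𝔭(K, E[p^∞]) · #E(ℚ_p)[p^∞] ≤ p^a`, `a ≤ ord_p #Ш(E/K)[p^∞] + 2((ord_p log_ω P − 1) − ord_p[E(K):ℤP]) + ord_p ∏_{w∣p} c_w`
  — from Kolyvagin (rank one, `Ш` finite), Poitou–Tate, the local Euler characteristic, `E(K)[p] = 0`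
  (from `Irr`, gen 17) and the torsion bookkeeping of gen 17 (`Ψ(E(ℚ_p)) = p^m ℤ_p`,
  `p^m = #E(ℚ_p)[p^∞]`; level bound `p^{min(k,e−m)}·p^m · #Ш · p^{min(k,e−m)}`).
* **`p2ControlUpperOnTreeAt_of_facts`** — `P2ControlUpperOnTreeAt W p` for EVERY `(W, p)` from the
  three facts: the typed input (T1ᵗ-CTL≤) of the statement of record is DISCHARGED everywhere
  (gen 16 needed (iv); the 3 771 ‖ 143 X11b-shape pairs where (iv) fails are now covered).
* **`P2.bsdp_of_onTree_algebraic`** — THE STATEMENT OF RECORD WITH NO CONTROL INPUT: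
  `∀ (E, p) ∈` X11b, `p ≥ 5 → BSD(E, p)` from sixteen published named facts and the typed inputs
  (T1ᵗ-IMC) `P2OpenInputOnTreeAt` [THE open input at `p ∥ N`], (T2α′), (T2♯-ℝ) `P2ShimuraDisplaysAt`,
  (T3), (T4′) — the ENTIRE algebraic side of Cas18 Thm. 2.3 `≤` is kernel theorems on all of X11b.

CONDITIONAL on the named facts; nothing booked; reach, census numbers and labels UNCHANGED.
References: [Castella2018] Thm. 2.3, (3.2.1), (calcul); [Castella2018Erratum] Thm. 1.1 (iv);
[JetchevSkinnerWan2017] Prop. 3.2.1, (7.1.5), §7.4.1; [MilneADT2006] I 2.8, 4.10(b); [Kolyvagin1990] Thm. A.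
-/

noncomputable section

open scoped Classical

open WeierstrassCurve NumberField IsDedekindDomain Field
open Literature.NumberTheory.EllipticCurves Literature.NumberTheory.EllipticCurves.GreenbergSelmer
  Literature.NumberTheory.EllipticCurves.ModularForms
  Literature.NumberTheory.EllipticCurves.Rank1Residual
  Literature.NumberTheory.EllipticCurves.Rank1Residual.Typed
  Literature.NumberTheory.EllipticCurves.Wuthrich2014
  Literature.NumberTheory.EllipticCurves.BalakrishnanEtAl2019
  Literature.NumberTheory.QuadraticFields.Quadratic
  Literature.NumberTheory.Automorphic
  Literature.NumberTheory.GaloisRepresentations Literature.NumberTheory.GaloisCohomology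
  Summit.BirchSwinnertonDyer.Rank1Residual.X11b.AcSelmer
  Summit.BirchSwinnertonDyer.Rank1Residual.X11b.LocBridge

namespace Summit.BirchSwinnertonDyer.Rank1Residual.X11b

/-! ### Transport of the torsion of `E(K_𝔭)` along `E(K_𝔭) ≃ E(ℚ_p)` -/

section Transport

variable (K : Type) [Field K] [NumberField K] (p : ℕ) [Fact p.Prime]
  (𝔭 : HeightOneSpectrum (𝓞 K)) (h𝔭 : ((p : ℕ) : 𝓞 K) ∈ 𝔭.asIdeal)
  (he : 𝔭.asIdeal.ramificationIdx (𝓞 ℚ) = 1) (hf : 𝔭.asIdeal.inertiaDeg (𝓞 ℚ) = 1)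
  (W : WeierstrassCurve ℚ)

/-- An additive isomorphism carries the torsion subgroup onto the torsion subgroup. [folklore] -/
theorem map_torsion_eq_of_addEquiv {A B : Type*} [AddCommGroup A] [AddCommGroup B] (e : A ≃+ B) :
    (AddCommGroup.torsion A).map e.toAddMonoidHom = AddCommGroup.torsion B := by
  apply le_antisymm
  · rintro _ ⟨t, ht, rfl⟩
    exact (AddCommGroup.mem_torsion _).mpr (e.toAddMonoidHom.isOfFinAddOrder ht)
  · intro y hy
    refine ⟨e.symm y, ?_, e.apply_symm_apply y⟩
    exact (AddCommGroup.mem_torsion _).mpr (e.symm.toAddMonoidHom.isOfFinAddOrder hy)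

include h𝔭 he hf in
/-- `[E(K_𝔭) : T + nE(K_𝔭)] = [E(ℚ_p) : T + nE(ℚ_p)]` (`T` the torsion subgroups). [folklore] -/
theorem index_torsion_sup_range_zsmul_eq_padic (n : ℤ) :
    (AddCommGroup.torsion ((W.baseChange K).baseChange (𝔭.adicCompletion K)).toAffine.Point ⊔
        (zsmulAddGroupHom n :
          ((W.baseChange K).baseChange (𝔭.adicCompletion K)).toAffine.Point →+ _).range).index =
      (AddCommGroup.torsion (W.baseChange ℚ_[p]).toAffine.Point ⊔
        (zsmulAddGroupHom n : (W.baseChange ℚ_[p]).toAffine.Point →+ _).range).index := by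
  set Φ := LocalIndexTransport.pointTransportPadic K p 𝔭 h𝔭 he hf W
  have h := AddSubgroup.index_map_of_bijective (f := Φ.toAddMonoidHom) Φ.bijective
    (AddCommGroup.torsion ((W.baseChange K).baseChange (𝔭.adicCompletion K)).toAffine.Point ⊔
      (zsmulAddGroupHom n :
        ((W.baseChange K).baseChange (𝔭.adicCompletion K)).toAffine.Point →+ _).range)
  rw [AddSubgroup.map_sup, map_torsion_eq_of_addEquiv,
    LocalIndexTransport.map_range_zsmul K p 𝔭 h𝔭 he hf W] at h
  exact h.symm

/-- `[E(K_𝔭) : im E(K) + (T + nE(K_𝔭))] = [E(ℚ_p) : im_ι E(K) + (T + nE(ℚ_p))]`, `ι = embAt K p 𝔭`.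
[folklore] -/
theorem index_range_baseChange_sup_torsion_sup_eq_padic (n : ℤ) :
    ((Affine.Point.baseChange (W' := W.baseChange K) K (𝔭.adicCompletion K)).range ⊔
        (AddCommGroup.torsion ((W.baseChange K).baseChange (𝔭.adicCompletion K)).toAffine.Point ⊔
          (zsmulAddGroupHom n :
            ((W.baseChange K).baseChange (𝔭.adicCompletion K)).toAffine.Point →+ _).range)).index =
      ((Affine.Point.map (W' := W) (embAt K p 𝔭 h𝔭 he hf).toRatAlgHom).range ⊔
        (AddCommGroup.torsion (W.baseChange ℚ_[p]).toAffine.Point ⊔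
          (zsmulAddGroupHom n : (W.baseChange ℚ_[p]).toAffine.Point →+ _).range)).index := by
  set Φ := LocalIndexTransport.pointTransportPadic K p 𝔭 h𝔭 he hf W
  have h := AddSubgroup.index_map_of_bijective (f := Φ.toAddMonoidHom) Φ.bijective
    ((Affine.Point.baseChange (W' := W.baseChange K) K (𝔭.adicCompletion K)).range ⊔
      (AddCommGroup.torsion ((W.baseChange K).baseChange (𝔭.adicCompletion K)).toAffine.Point ⊔
        (zsmulAddGroupHom n :
          ((W.baseChange K).baseChange (𝔭.adicCompletion K)).toAffine.Point →+ _).range))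
  rw [AddSubgroup.map_sup, AddSubgroup.map_sup, map_torsion_eq_of_addEquiv,
    LocalIndexTransport.map_range_baseChange K p 𝔭 h𝔭 he hf W,
    LocalIndexTransport.map_range_zsmul K p 𝔭 h𝔭 he hf W] at h
  exact h.symm

end Transport

/-! ### The Selmer count WITHOUT (iv) -/

/-- **The torsion-weighted Selmer bound FROM PUBLISHED FACTS, NO (iv).** For a globally minimal
elliptic `W/ℚ` and a prime `p`: at every datum of route p2 (X11b pair, `p ≥ 5`, Heegner field `K`,
Manin-good parametrisation, non-torsion Heegner point `P`, degree-one `𝔭 ∋ p`), Castella's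
`Sel_𝔭(K, E[p^∞])` is finite with `#Sel_𝔭(K, E[p^∞]) · #E(ℚ_p)[p^∞] ≤ p^a`,
`a ≤ ord_p #Ш(E/K)[p^∞] + 2((ord_p log_ω P − 1) − ord_p[E(K):ℤP]) + ord_p ∏_{w∣p} c_w(E/K)` — the `≤`
half of Cas18 (3.2.1) with (calcul), INCLUDING its factor `#H⁰(K_𝔭, E[p^∞])⁻¹ = #E(ℚ_p)[p^∞]⁻¹`
(JSW17 Prop. 3.2.1), from Kolyvagin's theorem (`rank E(K) = 1`, `Ш(E/K)` finite), Poitou–Tate over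
`K` (Milne I 4.10(b)), Tate's local Euler characteristic (Milne I 2.8) and `E(K)[p] = 0` (from `Irr`).
Proof: with `Ψ : E(ℚ_p) → ℤ_p` (`ker Ψ = T = E(ℚ_p)_tors`, `Ψ(E(ℚ_p)) = p^m ℤ_p`, `p^m = #E(ℚ_p)[p^∞]`)
and `e = v(Ψ Q_ι)` at a generator `Q` of `E(K)/tors`, every level has
`#H¹_{𝓛^{(k)}} ≤ [E(ℚ_p) : p^kE + ℤQ_ι] · #Ш[p^∞] · [E(ℚ_p) : T + p^kE + ℤQ_ι] ≤ (p^{e−m} p^m) · #Ш · p^{e−m}`,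
and `e + ord_p[E(K):ℤP] = v(Ψ P_ι) = ord_p log_ω P + ord_p c_p − 1`. CONDITIONAL on the named facts;
nothing booked. [cite: Castella2018, proof of Thm. 2.3, (3.2.1) and (calcul) (arXiv:1704.06608 pp. 5–6)]
[cite: JetchevSkinnerWan2017, Prop. 3.2.1 and (7.1.5) (arXiv:1512.06894 pp. 10–11, 16)]
[cite: MilneADT2006, Ch. I, Thm. 4.10(b) and Thm. 2.8] [cite: Kolyvagin1990, Thm. A] [cite: Gross1991, Thm. 1.3] -/
theorem p2SelmerCardBoundTorsion_of_facts (W : WeierstrassCurve ℚ) [W.IsElliptic]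
    [W.IsGloballyMinimal] (p : ℕ) [Fact p.Prime]
    (hKo : ∀ (N : ℕ) [NeZero N] (W : WeierstrassCurve ℚ) (K : Type) [Field K] [NumberField K],
      kolyvagin N W K)
    (hPT : ∀ (K : Type) [Field K] [NumberField K], poitouTate_sum_localTatePairing_eq_zero K)
    (hEP : ∀ (K : Type) [Field K] [NumberField K] (v : HeightOneSpectrum (𝓞 K)),
      localEulerPoincareCharacteristic (v.adicCompletion K)) :
    ∀ (N : ℕ) [NeZero N] (K : Type) [Field K] [NumberField K]
      (Dt : ModularParametrizationData W N) (H : HeegnerDatum N (NumberField.discr K)) (ι : K →+* ℂ)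
      (P : (W.baseChange K).toAffine.Point),
      ClassX11b W p → 5 ≤ p → Surj W p → W.conductorNorm ℤ = N → IsImaginaryQuadratic K →
      Odd (NumberField.discr K) → ¬ (p : ℤ) ∣ NumberField.discr K → ¬ p ∣ Units.torsionOrder K →
      SatisfiesHeegnerHypothesis N K →
      (W.quadraticTwist (NumberField.discr K : ℚ)).entireLFunction 1 ≠ 0 →
      WeierstrassCurve.Affine.Point.map ι.toRatAlgHom P = heegnerPointComplex Dt H →
      ¬ (p : ℤ) ∣ Dt.c → ¬ IsOfFinAddOrder P →
      ∀ (κ : ZpExtension K p), κ.IsAnticyclotomic →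
        ∀ (γ : Field.absoluteGaloisGroup K) [Fact (κ.IsTopGenerator γ)]
          (𝔭 : HeightOneSpectrum (𝓞 K)) (h𝔭 : ((p : ℕ) : 𝓞 K) ∈ 𝔭.asIdeal)
          (he : 𝔭.asIdeal.ramificationIdx (𝓞 ℚ) = 1) (hf : 𝔭.asIdeal.inertiaDeg (𝓞 ℚ) = 1),
          ∃ (_ : Finite (selmerAcBase (W.baseChange K) p 𝔭 ∅)) (a : ℕ),
            Nat.card (selmerAcBase (W.baseChange K) p 𝔭 ∅) *
                Nat.card (AddCommGroup.primaryComponent (W.baseChange ℚ_[p]).toAffine.Point p) ≤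
              p ^ a ∧
            (a : ℤ) ≤
              (padicValNat p (Nat.card (AddCommGroup.primaryComponent (W.baseChange K).sha p)) : ℤ) +
              2 * ((padicLogOrd W p (embAt K p 𝔭 h𝔭 he hf) P - 1) -
                (padicValNat p (AddSubgroup.zmultiples P).index : ℤ)) +
                padicValNat p (tamagawaProductAbove W K p) := by
  intro N _ K _ _ Dt Hg ι
  -- notation (fixed before the point `P` is introduced)
  set E := W.baseChange K with hEdef
  set G := W.baseChange ℚ_[p] with hGdef
  intro P hX hp5 hs hN hK hodd hpd hμ hHN hLt hP hc hPinf κ hκ γ _ 𝔭 h𝔭 he hf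
  haveI hEK : E.IsElliptic := by rw [hEdef, baseChange]; infer_instance
  obtain ⟨-, -, hmult, hirr⟩ := id hX
  have hpN : p ∣ W.conductorNorm ℤ := dvd_conductorNorm_of_mult hmult
  have hsplit : SplitsIn K p := hHN p Fact.out (hN ▸ hpN)
  have h2 : Module.finrank ℚ K = 2 := hK.1
  have hp : p.Prime := Fact.out
  -- Kolyvagin: `rank E(K) = 1`, `Ш(E/K)` finite
  obtain ⟨hrank, hSha⟩ := hKo N W K hK hHN ⟨Dt, Hg, ι, hP⟩ hPinf
  haveI hShaFin : Finite E.sha := hSha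
  set ιp := embAt K p 𝔭 h𝔭 he hf with hιp
  set f : E.toAffine.Point →+ G.toAffine.Point := Affine.Point.map (W' := W) ιp.toRatAlgHom with hfdef
  have hfapply : ∀ x, f x = padicPointOf W p ιp x := fun _ => rfl
  have hfinj : Function.Injective f := Affine.Point.map_injective (W' := W) ιp.toRatAlgHom
  -- no `p`-torsion in `E(K)` (from `Irr`, `K` quadratic)
  have hivK : ∀ x : E.toAffine.Point, p • x = 0 → x = 0 :=
    Transvection.forall_torsion_eq_zero_of_irr W p hirr K h2
  -- a coordinate `c : E(K) → ℤ` and a generator `Q`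
  obtain ⟨c, Q, hcQ, hcker⟩ := RankOne.exists_coord_of_mordellWeilRank_eq_one E hrank
  have hA : ∀ a : E.toAffine.Point, IsOfFinAddOrder (a - c a • Q) :=
    RankOne.isOfFinAddOrder_sub_coord_zsmul c Q hcQ hcker
  have hQinf : ¬ IsOfFinAddOrder Q := fun hQ => by
    have h := RankOne.coord_eq_zero_of_isOfFinAddOrder c hQ
    rw [hcQ] at h
    exact one_ne_zero h
  have hxinf : ¬ IsOfFinAddOrder (f Q) := fun hx => hQinf ((hfinj.isOfFinAddOrder_iff).mp hx)
  have hyinf : ¬ IsOfFinAddOrder (f P) := fun hy => hPinf ((hfinj.isOfFinAddOrder_iff).mp hy)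
  have hcP : c P ≠ 0 := fun h0 => hPinf (hcker P h0)
  -- the `ℤ_p`-coordinate `Ψ` on `E(ℚ_p)`: `Ψ(E(ℚ_p)) = p^m ℤ_p`, `p^m = #E(ℚ_p)[p^∞]`
  haveI hfi2 : (G.formalFiltration 2).FiniteIndex := G.finiteIndex_formalFiltration 2
  set cp := padicValNat p (G.localTamagawaNumber ℤ_[p]) with hcpdef
  obtain ⟨φ, hφ⟩ := LocalIndex.exists_addEquiv_valuation_psi_padicPointOf_of_mult W p hmult (K := K)
  obtain ⟨m, hmrange, hmcard, hmle⟩ :=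
    LocalIndex.exists_pow_eq_card_and_le_valuation_psi (G.formalFiltration 2) φ
  set Ψ := LocalIndex.psi (G.formalFiltration 2) φ with hΨ
  set eQ := (Ψ (f Q)).valuation with heQdef
  set eP := (Ψ (f P)).valuation with hePdef
  have hΨQ : Ψ (f Q) ≠ 0 := fun h0 => hxinf ((LocalIndex.psi_eq_zero_iff _ φ _).mp h0)
  have hmeQ : m ≤ eQ := hmle (f Q) hΨQ
  -- the exponents: `e(P) = padicLogOrd P + c_p − 1`, `e(P) = ord_p c(P) + e(Q)`
  have heP : (eP : ℤ) = padicLogOrd W p ιp P + cp - 1 := hφ ιp P hyinf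
  have hyx : f P = c P • f Q + f (P - c P • Q) := by rw [map_sub, map_zsmul]; abel
  have hePQ : eP = padicValNat p (c P).natAbs + eQ := by
    rw [hePdef, hyx]
    exact LocalIndex.valuation_psi_zsmul_add (G.formalFiltration 2) φ hxinf
      (f.isOfFinAddOrder (hA P)) hcP
  -- `ord_p [E(K) : ℤP] = ord_p |c(P)|`
  haveI : Finite (AddCommGroup.torsion E.toAffine.Point) := E.finite_torsion_point
  have hI : padicValNat p (AddSubgroup.zmultiples P).index = padicValNat p (c P).natAbs :=
    RankOne.padicValNat_index_zmultiples_eq c Q hcQ hcker hivK P hcP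
  -- (v) `ord_p ∏_{w∣p} c_w = 2 ord_p c_p`
  have htam : padicValNat p (tamagawaProductAbove W K p) = 2 * cp :=
    LocalIndexTransport.padicValNat_tamagawaProductAbove_eq_two_mul W K p h2 hsplit
  -- the two primes above `p`
  obtain ⟨σ, 𝔮, hσ, -, -, hall⟩ := LocalIndexTransport.exists_conj_prime_of_splitsIn K p h2 hsplit h𝔭
  have h𝔮 : ∀ v : HeightOneSpectrum (𝓞 K), v ≠ 𝔭 → ((p : ℕ) : 𝓞 K) ∈ v.asIdeal → v = 𝔮 :=
    fun v hv hpv => (hall v hpv).resolve_left hv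
  -- `Ш[p^k] ⊆ Ш[p^∞]`, `#Ш[p^∞] = p^v`
  set S := Nat.card (AddCommGroup.primaryComponent E.sha p) with hSdef
  obtain ⟨v, hv⟩ : ∃ v : ℕ, S = p ^ v := exists_natCard_primaryComponent_eq_pow p
  -- THE LEVEL BOUNDS
  set B : ℕ := (p ^ (eQ - m) * p ^ m) * (S * p ^ (eQ - m)) with hBdef
  have hlevel : ∀ k, Finite (acLevelStructure E p k 𝔭 ∅).selmerGroup ∧
      Nat.card (acLevelStructure E p k 𝔭 ∅).selmerGroup ≤ B := by
    intro k
    rcases Nat.eq_zero_or_pos k with rfl | hk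
    · obtain ⟨hfin, hle⟩ := finite_and_natCard_selmerGroup_acLevelStructure_zero E p 𝔭 ∅
      refine ⟨hfin, hle.trans ?_⟩
      have hS1 : 1 ≤ S := by rw [hv]; exact Nat.one_le_pow _ _ hp.pos
      calc 1 ≤ S := hS1
        _ ≤ S * p ^ (eQ - m) := Nat.le_mul_of_pos_right _ (pow_pos hp.pos _)
        _ ≤ (p ^ (eQ - m) * p ^ m) * (S * p ^ (eQ - m)) :=
            Nat.le_mul_of_pos_left _ (Nat.mul_pos (pow_pos hp.pos _) (pow_pos hp.pos _))
    · -- the indices at level `k`, read in `E(ℚ_p)` through `Ψ`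
      have hL₁ : ((Affine.Point.baseChange (W' := W.baseChange K) K (𝔭.adicCompletion K)).range ⊔
          (zsmulAddGroupHom ((p ^ k : ℕ) : ℤ) :
            ((W.baseChange K).baseChange (𝔭.adicCompletion K)).toAffine.Point →+ _).range).index ≤
          p ^ min k (eQ - m) * p ^ m := by
        rw [LocalIndexTransport.index_range_baseChange_sup_eq_padic K p 𝔭 h𝔭 he hf W,
          RankOne.range_zsmulAddGroupHom_natCast, sup_comm]
        change ((nsmulAddMonoidHom (p ^ k) : G.toAffine.Point →+ _).range ⊔ f.range).index ≤ _
        rw [LocalIndex.range_nsmul_sup_range_eq_of_source f c Q hA k hivK, hmcard]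
        exact LocalIndex.index_range_nsmul_sup_zmultiples_le (G.formalFiltration 2) φ hmrange
          (f Q) hxinf k
      have hM : (AddCommGroup.torsion ((W.baseChange K).baseChange (𝔭.adicCompletion K)).toAffine.Point ⊔
          (zsmulAddGroupHom ((p ^ k : ℕ) : ℤ) :
            ((W.baseChange K).baseChange (𝔭.adicCompletion K)).toAffine.Point →+ _).range).index =
          p ^ k := by
        rw [index_torsion_sup_range_zsmul_eq_padic K p 𝔭 h𝔭 he hf W,
          RankOne.range_zsmulAddGroupHom_natCast]
        exact LocalIndex.index_torsion_sup_range_nsmul (G.formalFiltration 2) φ k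
      have hN : ((zsmulAddGroupHom ((p ^ k : ℕ) : ℤ) : E.toAffine.Point →+ _).range).index =
          p ^ k := RankOne.index_range_zsmul_pow_eq c Q hcQ hcker hivK k
      have hL₂ : ((Affine.Point.baseChange (W' := W.baseChange K) K (𝔭.adicCompletion K)).range ⊔
          (AddCommGroup.torsion ((W.baseChange K).baseChange (𝔭.adicCompletion K)).toAffine.Point ⊔
            (zsmulAddGroupHom ((p ^ k : ℕ) : ℤ) :
              ((W.baseChange K).baseChange (𝔭.adicCompletion K)).toAffine.Point →+ _).range)).index =
          p ^ min k (eQ - m) := by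
        rw [index_range_baseChange_sup_torsion_sup_eq_padic K p 𝔭 h𝔭 he hf W,
          RankOne.range_zsmulAddGroupHom_natCast]
        change (f.range ⊔ (AddCommGroup.torsion G.toAffine.Point ⊔
          (nsmulAddMonoidHom (p ^ k) : G.toAffine.Point →+ _).range)).index = _
        have hrw : f.range ⊔ (AddCommGroup.torsion G.toAffine.Point ⊔
            (nsmulAddMonoidHom (p ^ k) : G.toAffine.Point →+ _).range) =
            AddCommGroup.torsion G.toAffine.Point ⊔
              ((nsmulAddMonoidHom (p ^ k) : G.toAffine.Point →+ _).range ⊔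
                AddSubgroup.zmultiples (f Q)) := by
          rw [← LocalIndex.range_nsmul_sup_range_eq_of_source f c Q hA k hivK]
          ac_rfl
        rw [hrw]
        exact LocalIndex.index_torsion_sup_range_nsmul_sup_zmultiples (G.formalFiltration 2) φ
          hmrange (f Q) hxinf k
      obtain ⟨hfin, hle⟩ := SelmerLevelBound.natCard_level_le_of_indices_torsion W K p k 𝔭 𝔮 hk
        σ hσ h𝔮 (hPT K) (hEP K 𝔮) rfl hM (pow_ne_zero _ hp.ne_zero) hN hL₂
        (natCard_sha_inf_torsionBy_le E p k)
      refine ⟨hfin, hle.trans ?_⟩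
      have hmin : p ^ min k (eQ - m) ≤ p ^ (eQ - m) := Nat.pow_le_pow_right hp.pos (min_le_right _ _)
      exact Nat.mul_le_mul (hL₁.trans (Nat.mul_le_mul_right _ hmin))
        (Nat.mul_le_mul_left _ hmin)
  -- pass to the limit
  obtain ⟨hfinSel, hcard⟩ := LevelKummer.exists_finite_selmerAcBase_natCard_le E p 𝔭 ∅
    E.zsmul_geomPoints_surjective_holds B (fun k => (hlevel k).1) (fun k => (hlevel k).2)
  refine ⟨hfinSel, v + 2 * eQ, ?_, ?_⟩
  · rw [← hmcard]
    calc Nat.card (selmerAcBase E p 𝔭 ∅) * p ^ m ≤ B * p ^ m := Nat.mul_le_mul_right _ hcard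
      _ = p ^ (v + 2 * eQ) := by
          rw [hBdef, hv, ← pow_add, ← pow_add, ← pow_add, ← pow_add]
          congr 1
          omega
  · have hvS : padicValNat p S = v := by rw [hv, padicValNat.prime_pow]
    rw [hvS, hI, htam]
    have hePQZ : (eP : ℤ) = (padicValNat p (c P).natAbs : ℤ) + (eQ : ℤ) := by exact_mod_cast hePQ
    have hcast : (((v + 2 * eQ : ℕ) : ℤ)) = (v : ℤ) + 2 * (eQ : ℤ) := by push_cast; ring
    have hcast2 : (((2 * cp : ℕ) : ℤ)) = 2 * (cp : ℤ) := by push_cast; ring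
    rw [hcast, hcast2]
    linarith [hePQZ, heP]

/-! ### The control input is a theorem on ALL of X11b -/

/-- **(T1ᵗ-CTL≤) `P2ControlUpperOnTreeAt W p` FROM PUBLISHED FACTS, for EVERY pair — NO (iv).**
Cas18 Thm. 2.3 `≤` on the constructed objects at every datum of route p2, from Kolyvagin's theorem,
Poitou–Tate (Milne I 4.10(b)) and Tate's local Euler characteristic (Milne I 2.8): the counting
snake lemma with the strict place counted (`BDPRouteControlStrictPlace`), Greenberg's Lemma 3.3 at
the bad `w ∤ p` with the Tamagawa bound (gen 14) and ABOVE `p` with the bound `#E(ℚ_p)[p^∞]`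
(`BDPRouteLocalKernelAtP[Padic]`), away descent (sibling), and the torsion-weighted Selmer count
`p2SelmerCardBoundTorsion_of_facts`. Gens 12–16 proved this under the erratum's hypothesis (iv)
`E(ℚ_p)[p] = 0`; here it holds on the whole class. CONDITIONAL on the three named facts; nothing
booked. [cite: Castella2018, Thm. 2.3 and its proof, (3.2.1), (calcul) (arXiv:1704.06608 pp. 5–6)]
[cite: GreenbergLNM1716, §3 Lemma 3.3 (p. 87), p. 90] [cite: JetchevSkinnerWan2017, Prop. 3.2.1 and §3.3 (shape)]
[cite: MilneADT2006, Ch. I, Thm. 4.10(b) and Thm. 2.8] [cite: Kolyvagin1990, Thm. A] -/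
theorem p2ControlUpperOnTreeAt_of_facts (W : WeierstrassCurve ℚ) [W.IsElliptic]
    [W.IsGloballyMinimal] (p : ℕ) [Fact p.Prime]
    (hKo : ∀ (N : ℕ) [NeZero N] (W : WeierstrassCurve ℚ) (K : Type) [Field K] [NumberField K],
      kolyvagin N W K)
    (hPT : ∀ (K : Type) [Field K] [NumberField K], poitouTate_sum_localTatePairing_eq_zero K)
    (hEP : ∀ (K : Type) [Field K] [NumberField K] (v : HeightOneSpectrum (𝓞 K)),
      localEulerPoincareCharacteristic (v.adicCompletion K)) :
    P2ControlUpperOnTreeAt W p :=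
  p2ControlUpperOnTreeAt_of_selmerCardBound_torsion (p2SelmerCardBoundTorsion_of_facts W p hKo hPT hEP)

/-! ### The statement of record with NO control input -/

/-- **THE STATEMENT OF RECORD, THE CONTROL INPUT DISCHARGED EVERYWHERE.** `∀ (E, p) ∈` X11b,
`p ≥ 5 → BSD(E, p)` from: FOURTEEN published named facts (Gross–Zagier, Kolyvagin ×2, Skinner 2016
Thm. C, Wuthrich Prop. 21, GZK, modularity ×2, Hoffstein–Luo, Friedberg–Hoffstein ×2, Mazur 1978,
Néron scaling, BDMTV) PLUS the two TEXTBOOK named facts Poitou–Tate (Milne I 4.10(b)) and Tate's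
local Euler–Poincaré characteristic (Milne I 2.8); and the typed inputs (T1ᵗ-IMC)
`P2OpenInputOnTreeAt` — THE open input at `p ∥ N` (one divisibility of the BDP main conjecture at the
trivial character composed with the BDP formula; erratum (2.4) ⇐ FW21 4.41, unrefereed); (T2α′);
(T2♯-ℝ) `P2ShimuraDisplaysAt`; (T3); (T4′). NO control input: the anticyclotomic control theorem
Cas18 Thm. 2.3 in `≤` form — Greenberg's Lemmas 3.2/3.3 (Tamagawa bound at `w ∣ N⁺ ∤ p`, torsion
bound at the strict `𝔭 ∣ p`), counting snake lemma, away descent — AND the base Selmer count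
(3.2.1)+(calcul) with its `#H⁰(K_𝔭, E[p^∞])`-factor are kernel theorems on ALL of X11b, with or
without the erratum's (iv). What route p2 still TYPES is exactly the analytic/Iwasawa side.
CONDITIONAL; nothing booked; reach, census numbers and labels UNCHANGED.
[cite: Castella2018, Thm. 2.3, (3.2.1) (arXiv:1704.06608 pp. 5–6), Thm. 3.2 (p. 9)]
[cite: Castella2018Erratum, Thm. 1.1, Thm. A′ and Remark] [cite: JetchevSkinnerWan2017, §7.4.1 and Prop. 3.2.1]
[cite: MilneADT2006, Ch. I, Thm. 4.10(b) and Thm. 2.8] [cite: Wuthrich2014, Prop. 21 (p. 400)] [cite: Skinner2016PacificMC, Thm. C] -/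
theorem P2.bsdp_of_onTree_algebraic
    -- published inputs (named facts of the tree)
    (hGZ : ∀ (N : ℕ) [NeZero N] (W : WeierstrassCurve ℚ) (K : Type) [Field K] [NumberField K],
      gross_zagier N W K)
    (hKo : ∀ (N : ℕ) [NeZero N] (W : WeierstrassCurve ℚ) (K : Type) [Field K] [NumberField K],
      kolyvagin N W K)
    (hB : ∀ (N : ℕ) [NeZero N] (W : WeierstrassCurve ℚ) (K : Type) [Field K] [NumberField K],
      Kolyvagin1990_padicValNat_card_sha_le N W K)
    (hSk : Skinner2016.thmC_padicValRat_bsd_rank_zero) (hWu : sha_dvd_analyticSha)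
    (hGZK : rank_eq_analyticRank_of_analyticRank_le_one) (hmod : hasEntireLFunction_rat)
    (hnf : exists_isNewformOf) (hHL : HoffsteinLuo1997_exists_twist_L_one_ne_zero)
    (hFHs : friedbergHoffstein_exists_heegnerField_split_twist_ne_zero)
    (hMaz : mazur_not_dvd_maninConstant_of_odd) (hNS : integral_neronScaling_of_isGloballyMinimal)
    (hBDMTV : thm12_not_le_normalizer_splitCartan)
    (hFH : friedbergHoffstein_exists_twist_ne_zero_inertAt)
    -- the two textbook facts (Milne ADT I 4.10(b), I 2.8)
    (hPT : ∀ (K : Type) [Field K] [NumberField K], poitouTate_sum_localTatePairing_eq_zero K)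
    (hEP : ∀ (K : Type) [Field K] [NumberField K] (v : HeightOneSpectrum (𝓞 K)),
      localEulerPoincareCharacteristic (v.adicCompletion K))
    -- (T1ᵗ-IMC) THE open input
    (hA : ∀ (W : WeierstrassCurve ℚ) [W.IsElliptic] [W.IsGloballyMinimal] (p : ℕ) [Fact p.Prime],
      P2OpenInputOnTreeAt W p)
    -- (T2α′)
    (hUα : ∀ (W : WeierstrassCurve ℚ) [W.IsElliptic] [W.IsGloballyMinimal] (p : ℕ) [Fact p.Prime],
      ClassX11b W p → 5 ≤ p → p ∣ W.tamagawaProduct →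
      (¬ Ram W p ∨ (W.HasSplitMultiplicativeReductionAtPrime p ∧
        p ∣ padicValInt p W.minimalDiscriminantInt)) → Typed.MissingUpperBoundAt W p)
    -- (T2♯-ℝ) the Shimura displays, weakest form
    (hSh : ∀ (W : WeierstrassCurve ℚ) [W.IsElliptic] [W.IsGloballyMinimal] (p : ℕ) [Fact p.Prime],
      ClassX11b W p → 5 ≤ p → P2ShimuraDisplaysAt W p)
    -- (T3)
    (hX11a : ∀ (Wd : WeierstrassCurve ℚ) [Wd.IsElliptic] [Wd.IsGloballyMinimal] (p : ℕ)
      [Fact p.Prime], ClassX11a Wd p → Typed.MissingLowerBoundAt Wd p)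
    -- (T4′)
    (hCorner : ∀ (W : WeierstrassCurve ℚ) [W.IsElliptic] [W.IsGloballyMinimal] (p : ℕ)
      [Fact p.Prime], ClassX11b W p → ¬ Surj W p → (p = 5 ∨ p = 7) →
        p ∣ padicValInt p W.minimalDiscriminantInt → ¬ Ram W p → Typed.MissingPPartAt W p)
    (W : WeierstrassCurve ℚ) [W.IsElliptic] [W.IsGloballyMinimal] (p : ℕ) [Fact p.Prime]
    (hX : ClassX11b W p) (hp5 : 5 ≤ p) : BSDp W p :=
  P2.bsdp_of_onTree_selmer_split hGZ hKo hB hSk hWu hGZK hmod hnf hHL hFHs hMaz hNS hBDMTV hFH hPT hEP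
    (fun W _ _ p _ _ => p2ControlUpperOnTreeAt_of_facts W p hKo hPT hEP) hA hUα hSh hX11a hCorner
    W p hX hp5

end Summit.BirchSwinnertonDyer.Rank1Residual.X11b

end
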